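import Mathlib
import HarnessLib
import Summits.CriticalPhenomena.Ising3DConformalLimit.Theorems.LatticeSDPCertificatesCertifiedWindowQualitativeStability
import Summits.CriticalPhenomena.Ising3DConformalLimit.Theorems.LatticeSDPCertificatesCertifiedWindowLPCompleteness

/-!
# Route `LatticeSDPCertificates`, crux `CertifiedWindow` (stmt-CriticalPhenomena-5504):
# the registered LP-form boundary stub holds with `k = k(R)`

Helper file (`--supports stmt-CriticalPhenomena-5504`). Capstone of lead c3's cycles 2–3: the
registered open stub `stub_boundaryScaleStabilityLP` of the crux skeleton (every ABSTRACT
level-`L` functional with normalisation, moment positivity, the one-site heat-bath rows and the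
lattice-bootstrap rows is one-scale-factor ratio stable against the bulk, with a depth `k`
INDEPENDENT of `R`) holds QUALITATIVELY — with `k = k(R)`, constant `1 + δ` in place of `K q^δ`,
and WITHOUT the lattice-bootstrap rows: an LP-feasible `E` is a level-`(L-1)` boundary-law
functional (`exists_boundaryLaw_of_rows`, LP completeness) and boundary-law functionals are
uniformly close to the bulk at fixed scales once the level is large (`boundaryLaw_axis_twoSided`,
uniqueness of the critical state). What remains open in the crux's boundary half is therefore
exactly the `R`-uniformity of `k` (a rate of boundary influence at `β_c(3)`). [folklore]
-/

noncomputable section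

namespace Summit.CriticalPhenomena.Ising3DConformalLimit.Theorems

open Literature.Probability.LatticeModels MeasureTheory Finset
open scoped symmDiff

/-- **The LP-form boundary stub with `k = k(R)`** (registered sub-goal
`stub_boundaryScaleStabilityLP_nonuniform` of item stmt-CriticalPhenomena-5504; one line, fully
qualified): for all `δ > 0`, `q ≥ 2`, `R` there is `k ≥ 1` such that every abstract functional `E`
on finite subsets of `ℤ³` that is normalised, moment-positive and satisfies the heat-bath rows at
every site of `Λ_L`, `L ≥ kR`, obeys `G(qn e₁) E{0,n e₁} ≤ (1+δ) G(n e₁) E{0,qn e₁}` for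
`1 ≤ n`, `qn ≤ R` — no lattice-bootstrap row is needed. Proof: `exists_boundaryLaw_of_rows` and
`boundaryLaw_axis_twoSided` at level `L - 1`. [folklore] -/
theorem stub_boundaryScaleStabilityLP_nonuniform : ∀ δ : ℝ, 0 < δ → ∀ q : ℕ, 2 ≤ q → ∀ R : ℕ, ∃ k : ℕ, 1 ≤ k ∧ ∀ (L : ℕ) (E : Finset (Literature.Probability.LatticeModels.Site 3) → ℝ), k * R ≤ L → E ∅ = 1 → (∀ (D : Finset (Literature.Probability.LatticeModels.Site 3)) (σ : Literature.Probability.LatticeModels.SpinConfig (Literature.Probability.LatticeModels.Site 3)), 0 ≤ ∑ A ∈ D.powerset, Literature.Probability.LatticeModels.spinProduct A σ * E A) → (∀ x : Literature.Probability.LatticeModels.Site 3, x ∈ Literature.Probability.LatticeModels.box 3 L → ∀ (τ : Literature.Probability.LatticeModels.SpinConfig (Literature.Probability.LatticeModels.Site 3)) (B : Finset (Literature.Probability.LatticeModels.Site 3)), x ∉ B → ∑ S ∈ ((Literature.Probability.LatticeModels.zdGraph 3).neighborFinset x).powerset, Literature.Probability.LatticeModels.spinProduct S τ * E (insert x (symmDiff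 B S)) = Real.tanh (Literature.Probability.LatticeModels.criticalBeta 3 * ∑ y ∈ (Literature.Probability.LatticeModels.zdGraph 3).neighborFinset x, Literature.Probability.LatticeModels.spinAt y τ) * ∑ S ∈ ((Literature.Probability.LatticeModels.zdGraph 3).neighborFinset x).powerset, Literature.Probability.LatticeModels.spinProduct S τ * E (symmDiff B S)) → ∀ n : ℕ, 1 ≤ n → q * n ≤ R → Literature.Probability.LatticeModels.criticalTwoPoint 3 (Pi.single 0 ((q * n : ℕ) : ℤ)) * E {0, Pi.single 0 (n : ℤ)} ≤ (1 + δ) * Literature.Probability.LatticeModels.criticalTwoPoint 3 (Pi.single 0 (n : ℤ)) * E {0, Pi.single 0 ((q * n : ℕ) : ℤ)} := by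
  intro δ hδ q hq R
  -- `δ' := δ/(2+δ)` has `(1+δ')/(1-δ') = 1+δ`
  set δ' : ℝ := δ / (2 + δ) with hδ'
  have hδ'pos : 0 < δ' := div_pos hδ (by linarith)
  obtain ⟨L₀, hL₀⟩ := boundaryLaw_axis_twoSided R hδ'pos
  refine ⟨L₀ + 2, by omega, fun L E hkR h0 hpos hrow n hn hqn => ?_⟩
  have hR : 2 ≤ R := le_trans (le_trans (by omega) (Nat.mul_le_mul hq hn)) hqn
  have hL1 : 1 ≤ L := by nlinarith
  have hL : L₀ ≤ L - 1 := by
    have : L₀ + 2 ≤ L := le_trans (by nlinarith) hkR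
    omega
  obtain ⟨ν, hνP, hνE⟩ := exists_boundaryLaw_of_rows L hL1 (criticalBeta 3) E h0 hpos hrow
  haveI := hνP
  have hqn1 : 1 ≤ q * n := Nat.mul_pos (by omega) hn
  obtain ⟨-, hEn⟩ := hL₀ (L - 1) hL ν n hn (le_trans (Nat.le_mul_of_pos_left n (by omega)) hqn)
  obtain ⟨hEq, -⟩ := hL₀ (L - 1) hL ν (q * n) hqn1 hqn
  -- the two pair sets lie in `Λ_L`, where `E` is the level-`(L-1)` functional of `ν`
  have hbox : ∀ j : ℕ, j ≤ R → ({0, Pi.single 0 (j : ℤ)} : Finset (Site 3)) ⊆ box 3 L := by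
    intro j hj
    refine pair_subset_box_three ?_
    rw [mem_box]
    intro i
    by_cases hi : i = 0
    · subst hi; simp only [Pi.single_eq_same]; constructor <;> nlinarith
    · simp only [Pi.single_eq_of_ne hi]; constructor <;> nlinarith
  rw [← hνE _ (hbox n (le_trans (Nat.le_mul_of_pos_left n (by omega)) hqn)),
    ← hνE _ (hbox (q * n) hqn)]
  have hGn : 0 < criticalTwoPoint 3 (Pi.single 0 (n : ℤ)) := criticalTwoPoint_axis_pos n
  have hGq : 0 < criticalTwoPoint 3 (Pi.single 0 ((q * n : ℕ) : ℤ)) :=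
    criticalTwoPoint_axis_pos (q * n)
  set Gn := criticalTwoPoint 3 (Pi.single 0 (n : ℤ))
  set Gq := criticalTwoPoint 3 (Pi.single 0 ((q * n : ℕ) : ℤ))
  set En := boundaryLawFunctional 3 (L - 1) (criticalBeta 3) ν {0, Pi.single 0 (n : ℤ)}
  set Eq := boundaryLawFunctional 3 (L - 1) (criticalBeta 3) ν {0, Pi.single 0 ((q * n : ℕ) : ℤ)}
  have h1 : Gq * En ≤ Gq * ((1 + δ') * Gn) := mul_le_mul_of_nonneg_left hEn hGq.le
  have hkey : (1 + δ') = (1 + δ) * (1 - δ') := by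
    rw [hδ']; field_simp; ring
  calc Gq * En ≤ Gq * ((1 + δ') * Gn) := h1
    _ = (1 + δ) * Gn * ((1 - δ') * Gq) := by rw [hkey]; ring
    _ ≤ (1 + δ) * Gn * Eq := by
        apply mul_le_mul_of_nonneg_left hEq
        exact mul_nonneg (by linarith) hGn.le

end Summit.CriticalPhenomena.Ising3DConformalLimit.Theorems
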